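import Summits.RiemannHypothesis.RiemannHypothesis.Theses.LiDirichletEcho
import Summits.RiemannHypothesis.RiemannHypothesis.Theorems.LiDirichletEchoCharWindowAdjust
import Summits.RiemannHypothesis.RiemannHypothesis.Theorems.LiDirichletEchoCharWindowConj
import Summits.RiemannHypothesis.RiemannHypothesis.Theorems.LiPrimeEchoAssembly
import Literature.NumberTheory.LFunctions.AutomorphicGRHProofs
import Literature.NumberTheory.Sieve.LiouvillePolynomialValuesMajorArcMR
import HarnessLib

/-!
# RiemannHypothesis / LiDirichletEcho — the ASSEMBLY (RH-FREE, GRH-FREE bookkeeping)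

RH-FREE · GRH-FREE [rh-li-eng g5, acting as prover on the unstaffed route].  Route `Theses/LiDirichletEcho.lean` (rung
«Li PRIME-ECHO LAW FOR DIRICHLET CHARACTERS» `LiTheory.LiZeroWindowEchoDirichlet`, L-P(P1χ); cell `pub/rh-li`, dossier
`theory/route/p5`), item `Assembly` (stmt-RiemannHypothesis-19402):

  `LiWindowContourChar → LiPrimeEdgeEchoChar → LiGammaShiftChar → LiHorizontalEdgesChar → LiTheory.LiZeroWindowEchoDirichlet`.

Proof = the theory seat's kernel-checked composition (planner rh-li-theory g7, HOME/theory/route/p5/SketchAll.lean and the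
birth skeleton `bc/Assembly_birth.lean`: `upper_law`, `liZeroWindowEchoDirichlet_of`, `Assembly_of_stubs`) fed with the two
landed RH-free support statements `charWindowAdjust_proof` (`CharWindowAdjust`, window ends `O(log n)`,
`Theorems/LiDirichletEchoCharWindowAdjust.lean`) and `charWindowConj_proof` (`CharWindowConj`, conjugation split,
`Theorems/LiDirichletEchoCharWindowConj.lean`): per character, pick good heights (K3χ), write the upper window trace by the
contour identity (K1χ), replace the gamma edge by the smooth mean (K4χ), the prime edge by the twisted echo (K2χ), bound the
horizontal edges (K3χ) and move the window back (`CharWindowAdjust`); then apply the per-character law to `χ` and `χ⁻¹`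
(primitive with `χ`), split the both-signs trace (`CharWindowConj`), use `S_{χ⁻¹} = S_χ` and
`twist(χ 2) + twist(χ⁻¹ 2) = 2 Re χ(2)·E₂`, halve, and pass from "all large `n`" to "all `n ≥ 2`"
(`PrimeEchoAssembly.eventually_to_all`).  Every sign and constant is checked by `linarith`; nothing here bears on the
truth of RH or GRH.
-/

noncomputable section

-- D-0017: `Summit.<S>.<S>.…` is the designed namespace of a single-problem summit.
set_option linter.dupNamespace false

open scoped ComplexConjugate

namespace Summit.RiemannHypothesis.RiemannHypothesis.Theorems.LiTheory

open Literature.NumberTheory.LFunctions Literature.NumberTheory.LFunctions.DirichletTheta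
open Summit.RiemannHypothesis.RiemannHypothesis.Theses.LiDirichletEcho

namespace DirichletEchoAssembly

-- adapted from the birth skeleton `bc/Assembly_birth.lean` (planner rh-li-theory g7): the two stub signatures are
-- replaced by the route's support decls `CharWindowAdjust`, `CharWindowConj` (verbatim the same statements).

-- `χ̄ = χ⁻¹` is primitive with `χ`: tree `Literature.NumberTheory.LFunctions.AutomorphicGRHOne.isPrimitive_inv`;
-- `χ⁻¹(a) = conj χ(a)`: tree `Literature.NumberTheory.Sieve.Teravainen2024.inv_apply_eq_conj_apply` (dedup: reused, not restated).

/-- `χ̄` has the parity of `χ`. -/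
theorem charParity_inv {q : ℕ} [NeZero q] (χ : DirichletCharacter ℂ q) : charParity χ⁻¹ = charParity χ := by
  rcases χ.even_or_odd with h | h
  · rw [charParity_of_even h, charParity_of_even ((ExplicitPsiChar.even_inv_iff χ).2 h)]
  · rw [charParity_of_odd h, charParity_of_odd ((ExplicitPsiChar.odd_inv_iff χ).2 h)]

/-- The smooth mean depends on `χ` only through `q` and the parity: `S_{χ̄} = S_χ`. -/
theorem charSmoothTraceWindow_inv {q : ℕ} [NeZero q] (χ : DirichletCharacter ℂ q) (n : ℕ) (T₁ T₂ : ℝ) :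
    charSmoothTraceWindow χ⁻¹ n T₁ T₂ = charSmoothTraceWindow χ n T₁ T₂ := by
  simp [charSmoothTraceWindow, charGammaDensity, charParity_inv]

/-- A character and its conjugate together hear `2 Re χ(2) · E₂(n)`. -/
theorem twist_pair {q : ℕ} (χ : DirichletCharacter ℂ q) (n : ℕ) :
    liPrimeEchoTwist (χ (2 : ZMod q)) 2 n + liPrimeEchoTwist (χ⁻¹ (2 : ZMod q)) 2 n
      = 2 * (χ (2 : ZMod q)).re * liPrimeEcho 2 n := by
  rw [Literature.NumberTheory.Sieve.Teravainen2024.inv_apply_eq_conj_apply, liPrimeEchoTwist_add_conj]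

/-- **PER-CHARACTER LAW.**  K1χ + K4χ + K2χ + K3χ + window adjustment ⇒ for ONE primitive character,
`|2 U_n(χ; √n, c√n) − S_χ(√n, c√n) + liPrimeEchoTwist (χ 2) 2 n| ≤ C log² n` for all large `n`. -/
theorem upper_law (hA : LiWindowContourChar) (hD : LiGammaShiftChar) (hE : LiPrimeEdgeEchoChar)
    (hF : LiHorizontalEdgesChar) (hG : CharWindowAdjust)
    {q : ℕ} [NeZero q] (χ : DirichletCharacter ℂ q) (hprim : χ.IsPrimitive) (hq : 1 < q) {c : ℝ} (hc : 5 / 4 ≤ c) :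
    ∃ N : ℕ, ∃ C : ℝ, ∀ n : ℕ, N ≤ n → 2 ≤ n →
      |2 * charUpperTraceWindow χ n (Real.sqrt n) (c * Real.sqrt n)
          - charSmoothTraceWindow χ n (Real.sqrt n) (c * Real.sqrt n) + liPrimeEchoTwist (χ (2 : ZMod q)) 2 n|
        ≤ C * Real.log n ^ 2 := by
  have hc1 : (1 : ℝ) ≤ c := by linarith
  obtain ⟨N₄, C₄, h4⟩ := hD q χ hprim hq c hc1
  obtain ⟨N₅, C₅, h5⟩ := hE q χ hprim hq c hc
  obtain ⟨N₆, C₆, h6⟩ := hF q χ hprim hq c hc1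
  obtain ⟨N₇, C₇, h7⟩ := hG q χ hprim hq c hc1
  set ℓ : ℝ := Real.log 2 with hℓ_def
  have hℓ : 0 < ℓ := Real.log_pos (by norm_num)
  refine ⟨max (max (max N₄ N₅) (max N₆ N₇)) 64, (3 * |C₇| + |C₄|) / ℓ + 2 * |C₆| + |C₅|, fun n hn h2 ↦ ?_⟩
  have hn4 : N₄ ≤ n := by omega
  have hn5 : N₅ ≤ n := by omega
  have hn6 : N₆ ≤ n := by omega
  have hn7 : N₇ ≤ n := by omega
  have h64 : (64 : ℝ) ≤ n := by exact_mod_cast (show 64 ≤ n by omega)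
  set s : ℝ := Real.sqrt n with hs_def
  have hs8 : 8 ≤ s := by
    have : Real.sqrt 64 = 8 := by
      rw [show (64 : ℝ) = 8 ^ 2 by norm_num]; exact Real.sqrt_sq (by norm_num)
    rw [← this]; exact Real.sqrt_le_sqrt h64
  have hs0 : 0 ≤ s := Real.sqrt_nonneg _
  have hcs : s ≤ c * s := le_mul_of_one_le_left hs0 hc1
  have hgap : 2 ≤ (c - 1) * s := by
    have := mul_le_mul (show (1 / 4 : ℝ) ≤ c - 1 by linarith) hs8 (by norm_num) (by linarith)
    linarith
  obtain ⟨T₁, hT₁l, hT₁u, hgood₁, hH₁⟩ := h6 n hn6 s le_rfl hcs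
  obtain ⟨T₂, hT₂l, hT₂u, hgood₂, hH₂⟩ := h6 n hn6 (c * s) hcs le_rfl
  have hlt : T₁ < T₂ := by nlinarith
  have hid := hA q χ hprim hq n T₁ T₂ (by linarith) hlt hgood₁ hgood₂
  have hgam := h4 n hn4 T₁ T₂ hT₁l hlt hT₂u
  have hpr := h5 n hn5 T₁ T₂ hT₁l hT₁u hT₂l hT₂u
  obtain ⟨hadjZ, hadjS⟩ := h7 n hn7 T₁ T₂ hT₁l hT₁u hT₂l hT₂u
  have key : 2 * charUpperTraceWindow χ n s (c * s) - charSmoothTraceWindow χ n s (c * s)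
        + liPrimeEchoTwist (χ (2 : ZMod q)) 2 n
      = 2 * (charUpperTraceWindow χ n s (c * s) - charUpperTraceWindow χ n T₁ T₂)
        - (charSmoothTraceWindow χ n s (c * s) - charSmoothTraceWindow χ n T₁ T₂)
        + (charGammaEdge χ n T₁ T₂ - charSmoothTraceWindow χ n T₁ T₂)
        - (charPrimeEdge χ n T₁ T₂ - liPrimeEchoTwist (χ (2 : ZMod q)) 2 n)
        + charHorizTerm χ n T₁ - charHorizTerm χ n T₂ := by
    linear_combination hid
  rw [key]
  set L : ℝ := Real.log n with hL_def
  have hLℓ : ℓ ≤ L := Real.log_le_log (by norm_num) (by exact_mod_cast h2)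
  have hL0 : 0 ≤ L := hℓ.le.trans hLℓ
  have hL2 : L ≤ L ^ 2 / ℓ := by
    rw [le_div_iff₀ hℓ, sq]; exact mul_le_mul_of_nonneg_left hLℓ hL0
  have b1 : C₇ * L ≤ |C₇| * (L ^ 2 / ℓ) :=
    (mul_le_mul_of_nonneg_right (le_abs_self C₇) hL0).trans (mul_le_mul_of_nonneg_left hL2 (abs_nonneg _))
  have b4 : C₄ * L ≤ |C₄| * (L ^ 2 / ℓ) :=
    (mul_le_mul_of_nonneg_right (le_abs_self C₄) hL0).trans (mul_le_mul_of_nonneg_left hL2 (abs_nonneg _))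
  have b5 : C₅ * L ^ 2 ≤ |C₅| * L ^ 2 := mul_le_mul_of_nonneg_right (le_abs_self C₅) (sq_nonneg _)
  have b6 : C₆ * L ^ 2 ≤ |C₆| * L ^ 2 := mul_le_mul_of_nonneg_right (le_abs_self C₆) (sq_nonneg _)
  have e : ((3 * |C₇| + |C₄|) / ℓ + 2 * |C₆| + |C₅|) * L ^ 2
      = 3 * (|C₇| * (L ^ 2 / ℓ)) + |C₄| * (L ^ 2 / ℓ) + |C₅| * L ^ 2 + 2 * (|C₆| * L ^ 2) := by
    field_simp
    ring
  rw [e]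
  rw [abs_le] at hadjZ hadjS hgam hpr hH₁ hH₂ ⊢
  constructor <;> linarith [hadjZ.1, hadjZ.2, hadjS.1, hadjS.2, hgam.1, hgam.2,
    hpr.1, hpr.2, hH₁.1, hH₁.2, hH₂.1, hH₂.2]

/-- **COMPOSITION.** The per-character law for `χ` and for `χ̄`, the conjugation split of the both-signs trace, the
parity invariance of the smooth mean and the twist algebra ⇒ the leaf. -/
theorem liZeroWindowEchoDirichlet_of (hA : LiWindowContourChar) (hD : LiGammaShiftChar)
    (hE : LiPrimeEdgeEchoChar) (hF : LiHorizontalEdgesChar) (hG : CharWindowAdjust) (hJ : CharWindowConj) :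
    LiZeroWindowEchoDirichlet := by
  intro q _ χ hprim hq c hc
  have hχ : χ ≠ 1 := ExplicitPsiChar.ne_one_of_isPrimitive hprim hq
  obtain ⟨N, C, hN⟩ := upper_law hA hD hE hF hG χ hprim hq hc
  obtain ⟨N', C', hN'⟩ := upper_law hA hD hE hF hG χ⁻¹ (Literature.NumberTheory.LFunctions.AutomorphicGRHOne.isPrimitive_inv hprim) hq hc
  refine PrimeEchoAssembly.eventually_to_all _ (max N N') ((C + C') / 2) fun n hn h2 ↦ ?_
  have h1 := hN n (le_of_max_le_left hn) h2
  have h1' := hN' n (le_of_max_le_right hn) h2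
  rw [charSmoothTraceWindow_inv] at h1'
  have hs0 : (0 : ℝ) ≤ Real.sqrt n := Real.sqrt_nonneg _
  have hcs : Real.sqrt n ≤ c * Real.sqrt n := le_mul_of_one_le_left hs0 (by linarith)
  have hsplit := hJ q χ hχ n (Real.sqrt n) (c * Real.sqrt n) hs0 hcs
  have htw := twist_pair χ n
  have key : charZeroTraceWindow χ n (Real.sqrt n) (c * Real.sqrt n)
        - charSmoothTraceWindow χ n (Real.sqrt n) (c * Real.sqrt n) + (χ (2 : ZMod q)).re * liPrimeEcho 2 n
      = ((2 * charUpperTraceWindow χ n (Real.sqrt n) (c * Real.sqrt n)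
            - charSmoothTraceWindow χ n (Real.sqrt n) (c * Real.sqrt n) + liPrimeEchoTwist (χ (2 : ZMod q)) 2 n)
          + (2 * charUpperTraceWindow χ⁻¹ n (Real.sqrt n) (c * Real.sqrt n)
            - charSmoothTraceWindow χ n (Real.sqrt n) (c * Real.sqrt n)
            + liPrimeEchoTwist (χ⁻¹ (2 : ZMod q)) 2 n)) / 2 := by
    rw [hsplit]; linear_combination (-1 / 2 : ℝ) * htw
  rw [key, abs_div, abs_two, div_le_iff₀ (by norm_num : (0 : ℝ) < 2)]
  calc |_| ≤ _ := abs_add_le _ _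
    _ ≤ C * Real.log n ^ 2 + C' * Real.log n ^ 2 := add_le_add h1 h1'
    _ = (C + C') / 2 * Real.log n ^ 2 * 2 := by ring

end DirichletEchoAssembly

open DirichletEchoAssembly in
/-- **Item `Assembly` of route `LiDirichletEcho`** (stmt-RiemannHypothesis-19402; RH-FREE, GRH-FREE bookkeeping), closed BY
NAME: the composition fed with the landed supports `charWindowAdjust_proof` and `charWindowConj_proof`. -/
theorem liDirichletEcho_assembly_proof :
    Summit.RiemannHypothesis.RiemannHypothesis.Theses.LiDirichletEcho.Assembly :=
  fun h1 h2 h4 h5 ↦ liZeroWindowEchoDirichlet_of h1 h4 h2 h5 charWindowAdjust_proof charWindowConj_proof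

end Summit.RiemannHypothesis.RiemannHypothesis.Theorems.LiTheory

end
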